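import Summits.CriticalPhenomena.PercolationContinuityZ3.Theorems.PercAnnulusCrossingIICMultiPointSharp
import Summits.CriticalPhenomena.PercolationContinuityZ3.Theorems.PercAnnulusCrossingIICMultiPointUpper
import Summits.CriticalPhenomena.PercolationContinuityZ3.Theorems.PercAnnulusCrossingRobustAnnulusUniqPlanar
import Summits.CriticalPhenomena.PercolationContinuityZ3.Theorems.PercAnnulusCrossingIICPlanarKesten
import HarnessLib

/-!
# The multipoint function of Kesten's IIC across separated scales: two-sided forms, `CU⁺_l + UAD` forms, and the planar case (lane RSW3, p1 gen 19)

builds on p205010 (kernel theorem, internal audit signed; external expert review pending) — NOT used in this file (only `p_c(ℤ^d) > 0`;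
the planar inputs are RSW at `p_c(ℤ²) = 1/2`).

RSW3 lane (LANE 3 `prim-rsw3`), seat `prim-rsw3-p1` (gen 19).  Helper file (`--supports stmt-CriticalPhenomena-4575`);
no definitions, no sorries.  Memo `run/shared/lean/prim/rsw3/P1-QM.md` §32.

Gen 19 (7) and (8b) give `c^k ∏ π(‖z_i‖) ≤ ν(z_0,…,z_{k−1} ∈ C(0)) ≤ A·C^k ∏ π(‖z_i‖)` across geometrically separated scales under
(A2)□(s,L) (+ `CU⁺_l` + UAD for the lower half).  Since robust conditional annulus-uniqueness `CU⁺_l` implies (A2)□ at aspect `(l, l²)`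
(gen 17), both halves hold under `CU⁺_l + UAD` alone; and since `CU⁺_9` and UAD hold at `p_c(ℤ²) = 1/2` (gen 18 (7), RSW), both halves hold
for the planar IIC UNCONDITIONALLY:

* `exists_iicMeasure_real_biInter_openConn_le_criticalProbI_of_robustCondAnnulusUniq` — upper half from `CU⁺_l` (`d ≥ 2`);
* `exists_prod_oneArmProb_le_iicMeasure_biInter_openConn_criticalProbI_of_robustCondAnnulusUniq` — lower half from `CU⁺_l + UAD` (`d ≥ 2`);
* `scales_of_shells` + **`exists_iicMeasure_real_biInter_openConn_two_sided_criticalProbI`** — the shells of (7) are admissible for (8b), so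
  under (A2)□(s,L) + `CU⁺_l` + UAD at `p_c(ℤ^d)`: **`c^k ∏ π(‖z_i‖)·ν(univ) ≤ ν(z_0,…,z_{k−1} ∈ C(0)) ≤ A·C^k ∏ π(‖z_i‖)`** in one statement;
* **`exists_iicMeasure_real_biInter_openConn_le_Z2`**, **`exists_prod_oneArmProb_le_iicMeasure_biInter_openConn_Z2`**,
  **`exists_iicMeasure_real_biInter_openConn_two_sided_Z2`** — `ℤ²`, unconditional:
  **Kesten's planar IIC satisfies `ν(z_0,…,z_{k−1} ∈ C(0)) ≍ C^{±k} ∏_i π_{1/2}(‖z_i‖)` across separated scales.**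
References: H. Kesten, Probab. Theory Relat. Fields 73 (1986), Thm. (8); G. Grimmett, *Percolation* (1999), §11.7 (RSW).
-/

noncomputable section

namespace Summit.CriticalPhenomena.PercolationContinuityZ3.Theorems.Crossing

open MeasureTheory Filter Topology Literature.Probability.Percolation Literature.Probability.LatticeModels
open Literature.Probability.Percolation.DCT16
open Summit.CriticalPhenomena.PercolationContinuityZ3.Theorems.SurfaceTension

variable {d : ℕ}

/-- **UPPER HALF FROM `CU⁺_l` ALONE** (`p_c(ℤ^d)`, `d ≥ 2`, `CU⁺_l(c_U)`, `l ≥ 2`, `c_U > 0`): there are `A, C > 0` with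
`ν(⋂_{i<k} {0 ↔ z_i}) ≤ A·C^k·∏_{i<k} π_{p_c}(n_i)` for every IIC measure `ν`, all scales `n_0 ≥ 4`, `8n_i ≤ n_{i+1}`, sites `‖z_i‖_∞ = n_i`, `k ≥ 1`.
[cite: Kesten1986, Thm. (8)] -/
theorem exists_iicMeasure_real_biInter_openConn_le_criticalProbI_of_robustCondAnnulusUniq (hd : 2 ≤ d) {l : ℕ} (hl : 2 ≤ l)
    {cU : ℝ} (hcU : 0 < cU)
    (hCU : ∀ a : ℕ, 1 ≤ a → ∀ E : Set (BondConfig (Site d)), IsUpperSet E → MeasurableSet E →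
      cU * (bondPercolation (zdGraph d) (criticalProbI d)).real E ≤ (bondPercolation (zdGraph d) (criticalProbI d)).real (E ∩
        {ω : BondConfig (Site d) | ∀ t ∈ innerBoundary (zdGraph d) (box d a), ∀ s ∈ innerBoundary (zdGraph d) (box d (l * a)),
          ∀ t' ∈ innerBoundary (zdGraph d) (box d a), ∀ s' ∈ innerBoundary (zdGraph d) (box d (l * a)),
          ω ∈ openConnIn (↑((box d (l * a) \ box d a) ∪ innerBoundary (zdGraph d) (box d a)) : Set (Site d)) t s →
          ω ∈ openConnIn (↑((box d (l * a) \ box d a) ∪ innerBoundary (zdGraph d) (box d a)) : Set (Site d)) t' s' →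
          ω ∈ openConnIn (↑((box d (l * a) \ box d a) ∪ innerBoundary (zdGraph d) (box d a)) : Set (Site d)) s s'})) :
    ∃ A C : ℝ, 0 < A ∧ 0 < C ∧ ∀ (ν : Measure (BondConfig (Site d))) [IsFiniteMeasure ν],
      (∀ (F : Finset (Sym2 (Site d))) (E : Set (BondConfig (Site d))), MeasurableSet E → DeterminedBy E ↑F →
        Tendsto (fun n : ℕ => (bondPercolation (zdGraph d) (criticalProbI d)).real (E ∩ siteToBoundary d n) /
          oneArmProb d (criticalProbI d) n) atTop (𝓝 (ν.real E))) →
      ∀ (n : ℕ → ℕ), 4 ≤ n 0 → (∀ i, 8 * n i ≤ n (i + 1)) → ∀ (z : ℕ → Site d), (∀ i, z i ∈ sphere d (n i)) →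
        ∀ k : ℕ, 1 ≤ k →
          ν.real (⋂ i ∈ Finset.range k, (openConn (0 : Site d) (z i) : Set (BondConfig (Site d)))) ≤
            A * C ^ k * ∏ i ∈ Finset.range k, oneArmProb d (criticalProbI d) (n i) := by
  have hA2 := setToSetQuasiMultAspectAt_of_robustCondAnnulusUniq hd hl hcU.le hCU
  have hd0 : (0 : ℝ) < d := by exact_mod_cast (lt_of_lt_of_le (by norm_num) hd)
  exact exists_iicMeasure_real_biInter_openConn_le_criticalProbI hd hl (by nlinarith) (by positivity) hA2

/-- **LOWER HALF FROM `CU⁺_l + UAD` ALONE** (`p_c(ℤ^d)`, `d ≥ 2`, `CU⁺_l(c_U)`, `l ≥ 2`, `c_U > 0`, UAD): there are `v ≥ 1`, `c > 0` with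
`c^k ∏_{i<k} π_{p_c}(‖z_i‖_∞) · ν(univ) ≤ ν(⋂_{i<k} {0 ↔ z_i})` for every IIC measure `ν`, `b₀ ≥ 1` and sites
`z_i ∈ Λ(64 v b₀ρ^i) ∖ Λ(32 v b₀ρ^i)`, `ρ = 64 l v`. [cite: Kesten1986, Thm. (8)] -/
theorem exists_prod_oneArmProb_le_iicMeasure_biInter_openConn_criticalProbI_of_robustCondAnnulusUniq (hd : 2 ≤ d) {l : ℕ} (hl : 2 ≤ l)
    {cU : ℝ} (hcU : 0 < cU)
    (hCU : ∀ a : ℕ, 1 ≤ a → ∀ E : Set (BondConfig (Site d)), IsUpperSet E → MeasurableSet E →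
      cU * (bondPercolation (zdGraph d) (criticalProbI d)).real E ≤ (bondPercolation (zdGraph d) (criticalProbI d)).real (E ∩
        {ω : BondConfig (Site d) | ∀ t ∈ innerBoundary (zdGraph d) (box d a), ∀ s ∈ innerBoundary (zdGraph d) (box d (l * a)),
          ∀ t' ∈ innerBoundary (zdGraph d) (box d a), ∀ s' ∈ innerBoundary (zdGraph d) (box d (l * a)),
          ω ∈ openConnIn (↑((box d (l * a) \ box d a) ∪ innerBoundary (zdGraph d) (box d a)) : Set (Site d)) t s →
          ω ∈ openConnIn (↑((box d (l * a) \ box d a) ∪ innerBoundary (zdGraph d) (box d a)) : Set (Site d)) t' s' →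
          ω ∈ openConnIn (↑((box d (l * a) \ box d a) ∪ innerBoundary (zdGraph d) (box d a)) : Set (Site d)) s s'}))
    (hUAD : ∀ ε : ℝ, 0 < ε → ∃ K₀ : ℕ, ∀ m : ℕ, 1 ≤ m → ∀ N : ℕ, K₀ * m ≤ N →
      (bondPercolation (zdGraph d) (criticalProbI d)).real (boxCrossing d m N) ≤ ε) :
    ∃ (v : ℕ) (c : ℝ), 1 ≤ v ∧ 0 < c ∧ ∀ (ν : Measure (BondConfig (Site d))) [IsFiniteMeasure ν],
      (∀ (F : Finset (Sym2 (Site d))) (E : Set (BondConfig (Site d))), MeasurableSet E → DeterminedBy E ↑F →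
        Tendsto (fun n : ℕ => (bondPercolation (zdGraph d) (criticalProbI d)).real (E ∩ siteToBoundary d n) /
          oneArmProb d (criticalProbI d) n) atTop (𝓝 (ν.real E))) →
      ∀ (b₀ : ℕ), 1 ≤ b₀ → ∀ (z : ℕ → Site d),
        (∀ i, z i ∈ box d (64 * (v * (b₀ * (64 * l * v) ^ i))) \ box d (32 * (v * (b₀ * (64 * l * v) ^ i)))) →
        ∀ k : ℕ, c ^ k * (∏ i ∈ Finset.range k, oneArmProb d (criticalProbI d) (Site.supNorm (z i))) * ν.real Set.univ ≤
          ν.real (⋂ i ∈ Finset.range k, (openConn (0 : Site d) (z i) : Set (BondConfig (Site d)))) := by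
  have hA2 := setToSetQuasiMultAspectAt_of_robustCondAnnulusUniq hd hl hcU.le hCU
  have hd0 : (0 : ℝ) < d := by exact_mod_cast (lt_of_lt_of_le (by norm_num) hd)
  exact exists_prod_oneArmProb_le_iicMeasure_biInter_openConn_criticalProbI hd hl (by nlinarith) (by positivity) hA2 hl hcU hCU hUAD

/-- Scales of the shells: if `z_i ∈ Λ(64 v b₀ρ^i) ∖ Λ(32 v b₀ρ^i)` with `ρ = 64 l v`, `l ≥ 2`, `v, b₀ ≥ 1`, then `n_i = ‖z_i‖_∞` satisfies
`4 ≤ n_0`, `8 n_i ≤ n_{i+1}` and `z_i ∈ sphere(n_i)` — the shells of gen 19 (7) are admissible for gen 19 (8b). [folklore] -/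
theorem scales_of_shells {l v b₀ : ℕ} (hl : 2 ≤ l) (hv : 1 ≤ v) (hb₀ : 1 ≤ b₀) {z : ℕ → Site d}
    (hz : ∀ i, z i ∈ box d (64 * (v * (b₀ * (64 * l * v) ^ i))) \ box d (32 * (v * (b₀ * (64 * l * v) ^ i)))) :
    4 ≤ Site.supNorm (z 0) ∧ (∀ i, 8 * Site.supNorm (z i) ≤ Site.supNorm (z (i + 1))) ∧ ∀ i, z i ∈ sphere d (Site.supNorm (z i)) := by
  have hmem : ∀ i, Site.supNorm (z i) ≤ 64 * (v * (b₀ * (64 * l * v) ^ i)) ∧ 32 * (v * (b₀ * (64 * l * v) ^ i)) < Site.supNorm (z i) := by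
    intro i
    have h := hz i
    rw [Finset.mem_sdiff, mem_box_iff_supNorm_le, mem_box_iff_supNorm_le] at h
    omega
  refine ⟨?_, fun i => ?_, fun i => self_mem_sphere (z i)⟩
  · have h := (hmem 0).2
    have : 1 ≤ v * (b₀ * (64 * l * v) ^ 0) := Nat.one_le_iff_ne_zero.2 (by positivity)
    omega
  · have h1 := (hmem i).1
    have h2 := (hmem (i + 1)).2
    have hX : 8 * (64 * (v * (b₀ * (64 * l * v) ^ i))) ≤ 32 * (v * (b₀ * (64 * l * v) ^ (i + 1))) := by
      have hρ : 16 ≤ 64 * l * v := by nlinarith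
      have : 8 * (64 * (v * (b₀ * (64 * l * v) ^ i))) = 32 * (v * (b₀ * (64 * l * v) ^ i)) * 16 := by ring
      rw [this, pow_succ, show 32 * (v * (b₀ * ((64 * l * v) ^ i * (64 * l * v)))) = 32 * (v * (b₀ * (64 * l * v) ^ i)) * (64 * l * v) by ring]
      exact Nat.mul_le_mul_left _ hρ
    omega

/-- **THE MULTIPOINT FUNCTION OF KESTEN'S IIC ACROSS SEPARATED SCALES FACTORISES** (`p_c(ℤ^d)`, `d ≥ 2`; (A2)□ at aspect `(s,L)`, `2 ≤ s ≤ L`,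
`ϰ > 0`; `CU⁺_l(c_U)`, `l ≥ 2`, `c_U > 0`; UAD): there are `v ≥ 1` and `c, A, C > 0` such that for every finite measure `ν` with Kesten's IIC limit
property, every `b₀ ≥ 1`, all sites `z_i ∈ Λ(64 v b₀ρ^i) ∖ Λ(32 v b₀ρ^i)` (`ρ = 64 l v`) and every `k ≥ 1`:
**`c^k·∏_{i<k} π_{p_c}(‖z_i‖_∞)·ν(univ) ≤ ν(⋂_{i<k} {0 ↔ z_i}) ≤ A·C^k·∏_{i<k} π_{p_c}(‖z_i‖_∞)`**. [cite: Kesten1986, Thm. (8)] [cite: BasuSapozhnikov2017ECP, Thm. 1.1] -/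
theorem exists_iicMeasure_real_biInter_openConn_two_sided_criticalProbI (hd : 2 ≤ d) {s L : ℕ} (hs : 2 ≤ s) (hsL : s ≤ L) {ϰ : ℝ}
    (hϰ : 0 < ϰ) (hA2 : SetToSetQuasiMultAspectAt d (criticalProbI d) s L ϰ) {l : ℕ} (hl : 2 ≤ l) {cU : ℝ} (hcU : 0 < cU)
    (hCU : ∀ a : ℕ, 1 ≤ a → ∀ E : Set (BondConfig (Site d)), IsUpperSet E → MeasurableSet E →
      cU * (bondPercolation (zdGraph d) (criticalProbI d)).real E ≤ (bondPercolation (zdGraph d) (criticalProbI d)).real (E ∩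
        {ω : BondConfig (Site d) | ∀ t ∈ innerBoundary (zdGraph d) (box d a), ∀ s ∈ innerBoundary (zdGraph d) (box d (l * a)),
          ∀ t' ∈ innerBoundary (zdGraph d) (box d a), ∀ s' ∈ innerBoundary (zdGraph d) (box d (l * a)),
          ω ∈ openConnIn (↑((box d (l * a) \ box d a) ∪ innerBoundary (zdGraph d) (box d a)) : Set (Site d)) t s →
          ω ∈ openConnIn (↑((box d (l * a) \ box d a) ∪ innerBoundary (zdGraph d) (box d a)) : Set (Site d)) t' s' →
          ω ∈ openConnIn (↑((box d (l * a) \ box d a) ∪ innerBoundary (zdGraph d) (box d a)) : Set (Site d)) s s'}))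
    (hUAD : ∀ ε : ℝ, 0 < ε → ∃ K₀ : ℕ, ∀ m : ℕ, 1 ≤ m → ∀ N : ℕ, K₀ * m ≤ N →
      (bondPercolation (zdGraph d) (criticalProbI d)).real (boxCrossing d m N) ≤ ε) :
    ∃ (v : ℕ) (c A C : ℝ), 1 ≤ v ∧ 0 < c ∧ 0 < A ∧ 0 < C ∧ ∀ (ν : Measure (BondConfig (Site d))) [IsFiniteMeasure ν],
      (∀ (F : Finset (Sym2 (Site d))) (E : Set (BondConfig (Site d))), MeasurableSet E → DeterminedBy E ↑F →
        Tendsto (fun n : ℕ => (bondPercolation (zdGraph d) (criticalProbI d)).real (E ∩ siteToBoundary d n) /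
          oneArmProb d (criticalProbI d) n) atTop (𝓝 (ν.real E))) →
      ∀ (b₀ : ℕ), 1 ≤ b₀ → ∀ (z : ℕ → Site d),
        (∀ i, z i ∈ box d (64 * (v * (b₀ * (64 * l * v) ^ i))) \ box d (32 * (v * (b₀ * (64 * l * v) ^ i)))) →
        ∀ k : ℕ, 1 ≤ k →
          c ^ k * (∏ i ∈ Finset.range k, oneArmProb d (criticalProbI d) (Site.supNorm (z i))) * ν.real Set.univ ≤
              ν.real (⋂ i ∈ Finset.range k, (openConn (0 : Site d) (z i) : Set (BondConfig (Site d)))) ∧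
            ν.real (⋂ i ∈ Finset.range k, (openConn (0 : Site d) (z i) : Set (BondConfig (Site d)))) ≤
              A * C ^ k * ∏ i ∈ Finset.range k, oneArmProb d (criticalProbI d) (Site.supNorm (z i)) := by
  obtain ⟨v, c, hv, hc, hlow⟩ := exists_prod_oneArmProb_le_iicMeasure_biInter_openConn_criticalProbI hd hs hsL hϰ hA2 hl hcU hCU hUAD
  obtain ⟨A, C, hA, hC, hup⟩ := exists_iicMeasure_real_biInter_openConn_le_criticalProbI hd hs hsL hϰ hA2
  refine ⟨v, c, A, C, hv, hc, hA, hC, fun ν _ hν b₀ hb₀ z hz k hk => ⟨hlow ν hν b₀ hb₀ z hz k, ?_⟩⟩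
  obtain ⟨h0, hgrow, hsph⟩ := scales_of_shells (d := d) hl hv hb₀ hz
  exact hup ν hν (fun i => Site.supNorm (z i)) h0 hgrow z hsph k hk

/-- **PLANAR, UNCONDITIONAL — UPPER HALF**: at `p_c(ℤ²) = 1/2` there are `A, C > 0` with
**`ν(z_0,…,z_{k−1} ∈ C(0)) ≤ A·C^k·∏_{i<k} π(‖z_i‖_∞)`** for every planar IIC measure `ν`, all scales `n_0 ≥ 4`, `8n_i ≤ n_{i+1}`, sites
`‖z_i‖_∞ = n_i` and `k ≥ 1` ((A2)□ at aspect `(9,77)` from RSW). [cite: Kesten1986, Thm. (8)] -/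
theorem exists_iicMeasure_real_biInter_openConn_le_Z2 :
    ∃ A C : ℝ, 0 < A ∧ 0 < C ∧ ∀ (ν : Measure (BondConfig (Site 2))) [IsFiniteMeasure ν],
      (∀ (F : Finset (Sym2 (Site 2))) (E : Set (BondConfig (Site 2))), MeasurableSet E → DeterminedBy E ↑F →
        Tendsto (fun n : ℕ => (bondPercolation (zdGraph 2) (criticalProbI 2)).real (E ∩ siteToBoundary 2 n) /
          oneArmProb 2 (criticalProbI 2) n) atTop (𝓝 (ν.real E))) →
      ∀ (n : ℕ → ℕ), 4 ≤ n 0 → (∀ i, 8 * n i ≤ n (i + 1)) → ∀ (z : ℕ → Site 2), (∀ i, z i ∈ sphere 2 (n i)) →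
        ∀ k : ℕ, 1 ≤ k →
          ν.real (⋂ i ∈ Finset.range k, (openConn (0 : Site 2) (z i) : Set (BondConfig (Site 2)))) ≤
            A * C ^ k * ∏ i ∈ Finset.range k, oneArmProb 2 (criticalProbI 2) (n i) := by
  obtain ⟨ϰ, hϰ, hA2⟩ := exists_setToSetQuasiMultAspectAt_two_of_criticalProbI_le
  exact exists_iicMeasure_real_biInter_openConn_le_criticalProbI (d := 2) le_rfl (s := 9) (L := 77) (by norm_num) (by norm_num) hϰ
    (hA2 _ le_rfl)

/-- **PLANAR, UNCONDITIONAL — LOWER HALF**: at `p_c(ℤ²) = 1/2` there are `v ≥ 1`, `c > 0` with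
**`c^k·∏_{i<k} π(‖z_i‖_∞)·ν(univ) ≤ ν(z_0,…,z_{k−1} ∈ C(0))`** for every planar IIC measure `ν`, every `b₀ ≥ 1` and sites
`z_i ∈ Λ(64 v b₀ρ^i) ∖ Λ(32 v b₀ρ^i)`, `ρ = 576 v` (`CU⁺_9` and UAD from RSW).  With the upper half: **the multipoint function of Kesten's
planar IIC factorises across separated scales, `ν(z_0,…,z_{k−1} ∈ C(0)) ≍ C^{±k} ∏ π(‖z_i‖)`.** [cite: Kesten1986, Thm. (8)] -/
theorem exists_prod_oneArmProb_le_iicMeasure_biInter_openConn_Z2 :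
    ∃ (v : ℕ) (c : ℝ), 1 ≤ v ∧ 0 < c ∧ ∀ (ν : Measure (BondConfig (Site 2))) [IsFiniteMeasure ν],
      (∀ (F : Finset (Sym2 (Site 2))) (E : Set (BondConfig (Site 2))), MeasurableSet E → DeterminedBy E ↑F →
        Tendsto (fun n : ℕ => (bondPercolation (zdGraph 2) (criticalProbI 2)).real (E ∩ siteToBoundary 2 n) /
          oneArmProb 2 (criticalProbI 2) n) atTop (𝓝 (ν.real E))) →
      ∀ (b₀ : ℕ), 1 ≤ b₀ → ∀ (z : ℕ → Site 2),
        (∀ i, z i ∈ box 2 (64 * (v * (b₀ * (64 * 9 * v) ^ i))) \ box 2 (32 * (v * (b₀ * (64 * 9 * v) ^ i)))) →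
        ∀ k : ℕ, c ^ k * (∏ i ∈ Finset.range k, oneArmProb 2 (criticalProbI 2) (Site.supNorm (z i))) * ν.real Set.univ ≤
          ν.real (⋂ i ∈ Finset.range k, (openConn (0 : Site 2) (z i) : Set (BondConfig (Site 2)))) := by
  obtain ⟨cU, hcU, hCU⟩ := robustCondAnnulusUniq_Z2
  exact exists_prod_oneArmProb_le_iicMeasure_biInter_openConn_criticalProbI_of_robustCondAnnulusUniq (d := 2) le_rfl (l := 9)
    (by norm_num) hcU (hCU 9 le_rfl) uad_Z2

/-- **PLANAR, UNCONDITIONAL — TWO-SIDED**: at `p_c(ℤ²) = 1/2` there are `v ≥ 1` and `c, A, C > 0` with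
**`c^k·∏_{i<k} π(‖z_i‖_∞)·ν(univ) ≤ ν(z_0,…,z_{k−1} ∈ C(0)) ≤ A·C^k·∏_{i<k} π(‖z_i‖_∞)`** for every planar IIC measure `ν`, every `b₀ ≥ 1`,
all sites `z_i ∈ Λ(64 v b₀ρ^i) ∖ Λ(32 v b₀ρ^i)` (`ρ = 576 v`) and every `k ≥ 1`. [cite: Kesten1986, Thm. (8)] -/
theorem exists_iicMeasure_real_biInter_openConn_two_sided_Z2 :
    ∃ (v : ℕ) (c A C : ℝ), 1 ≤ v ∧ 0 < c ∧ 0 < A ∧ 0 < C ∧ ∀ (ν : Measure (BondConfig (Site 2))) [IsFiniteMeasure ν],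
      (∀ (F : Finset (Sym2 (Site 2))) (E : Set (BondConfig (Site 2))), MeasurableSet E → DeterminedBy E ↑F →
        Tendsto (fun n : ℕ => (bondPercolation (zdGraph 2) (criticalProbI 2)).real (E ∩ siteToBoundary 2 n) /
          oneArmProb 2 (criticalProbI 2) n) atTop (𝓝 (ν.real E))) →
      ∀ (b₀ : ℕ), 1 ≤ b₀ → ∀ (z : ℕ → Site 2),
        (∀ i, z i ∈ box 2 (64 * (v * (b₀ * (64 * 9 * v) ^ i))) \ box 2 (32 * (v * (b₀ * (64 * 9 * v) ^ i)))) →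
        ∀ k : ℕ, 1 ≤ k →
          c ^ k * (∏ i ∈ Finset.range k, oneArmProb 2 (criticalProbI 2) (Site.supNorm (z i))) * ν.real Set.univ ≤
              ν.real (⋂ i ∈ Finset.range k, (openConn (0 : Site 2) (z i) : Set (BondConfig (Site 2)))) ∧
            ν.real (⋂ i ∈ Finset.range k, (openConn (0 : Site 2) (z i) : Set (BondConfig (Site 2)))) ≤
              A * C ^ k * ∏ i ∈ Finset.range k, oneArmProb 2 (criticalProbI 2) (Site.supNorm (z i)) := by
  obtain ⟨cU, hcU, hCU⟩ := robustCondAnnulusUniq_Z2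
  have hA2 := setToSetQuasiMultAspectAt_of_robustCondAnnulusUniq (d := 2) le_rfl (l := 9) (by norm_num) hcU.le (hCU 9 le_rfl)
  exact exists_iicMeasure_real_biInter_openConn_two_sided_criticalProbI (d := 2) le_rfl (by norm_num) (by norm_num) (by positivity) hA2
    (by norm_num) hcU (hCU 9 le_rfl) uad_Z2

end Summit.CriticalPhenomena.PercolationContinuityZ3.Theorems.Crossing

end
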